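import Summits.QuantumFields.YangMills.Theorems.LuscherReductionOneSiteLevelsValleySchurKernel

/-!
# VALLEY, step 3b: the weighted Schur test on a region, cross terms and the pigeonholed slab
# (support module for `stub_absUpperValleyMag` of crux `OneSiteLevels`, route `LuscherReduction`, item stmt-QuantumFields-20007;
# fleet lead prover ym-luscher-20007-p1 g2)

Abstract assembly of the VALLEY gain from per-shell supersolution bounds.  Fix `B > 0`, an inner radius `ρ₀` (the test function `f`
vanishes on `{ρ < ρ₀}`, `ρ(U) = ‖zmCoord 1 U‖`), a window `[T, 2T]` for the shell boundary and a slab width `w`.  Suppose that for EVERY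
boundary `t ∈ [T, 2T]` the weighted supersolution quantities

  `J_τ(U) = e^{(τ−½)BS(U)} ∫ E_B(U,V) e^{−(½+τ)BS(V)} dV`

satisfy `J_{τ(t)}(U) ≤ Λ` on the lower shell `ρ₀ ≤ ρ(U) < t` and `J_0(U) ≤ Λ` on the upper shell `ρ(U) ≥ t`.  Then (`qform_le_of_twoShell`)

  `⟨f, K_B f⟩ ≤ (Λ + linkCE B / J + 3 e^{6B − Bw²}) ‖f‖²`,   `J` = number of disjoint candidate slabs in the window.

Proof: choose the boundary `t` among `J` candidates so that the slab `{t − w ≤ ρ < t + w}` carries at most `‖f‖²/J` of the mass of `f`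
(pigeonhole); split `f = f₁ + f₂` along `t`; the diagonal terms are bounded by the WEIGHTED SCHUR TEST (`Literature.…SchurTestKernel`,
weights `e^{−τBS}` and `1`), the cross terms between the slab halves by the unweighted Schur test (row sums `linkCE`), and all other cross
terms by the Gaussian decay of the kinetic factor across a radial gap `w`: `E_B(U,V) ≤ e^{6B − B(ρ(U)−ρ(V))²}` (`linkE_le_exp_gap`).
No positivity of the transfer form is used (the split is an exact bilinear expansion), so no constant is lost.

## WHAT THIS IS NOT
The per-shell bounds are hypotheses here (modules `…ValleyFar`, `…ValleyNear`); NOT the crux, NOT THE CLAY GAP.  Sorry-free; no new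
definition, no named fact.
-/

set_option autoImplicit false

noncomputable section

open MeasureTheory Filter Topology Real
open scoped Matrix Quaternion RealInnerProductSpace
open Literature.MathematicalPhysics.QuantumFieldTheory
open Literature.MathematicalPhysics.QuantumLattice
open Literature.Analysis.OperatorTheory.YMMatrixModel
open Literature.Analysis.OperatorTheory.SchurTest

namespace Summit.QuantumFields.YangMills.Theorems.FemtoTransferGap

section Bilinear

variable {B : ℝ}

open Classical in
/-- **Weighted Schur test on a region.**  Let `S` be measurable, `a` bounded measurable vanishing off `S`, `½ + τ ≥ 0`, `Λ ≥ 0`, and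
suppose the supersolution bound `J_τ(U) = e^{(τ−½)BS(U)} ∫ E_B(U,V) e^{−(½+τ)BS(V)} dV ≤ Λ` at every `U ∈ S`.  Then
`∫ a K_B a ≤ Λ ∫ a²` (weight `h = e^{−τBS}`, kernel `K_B` restricted to `S × S`).
[cite: Grafakos2009, App. A.2, Lemma ((iii) ⇒ (i), p = 2)] -/
theorem prodIntegral_le_weighted (hB : 0 < B) {τ Λ : ℝ} (hΛ : 0 ≤ Λ) {S : Set Cfg} (hS : MeasurableSet S)
    {a : Cfg → ℝ} (ha : Measurable a) (hab : ∃ C : ℝ, ∀ U, |a U| ≤ C) (ha0 : ∀ U, U ∉ S → a U = 0)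
    (hrow : ∀ U ∈ S, Real.exp ((τ - 1 / 2) * B * wilsonAction su2Rep U) *
      ∫ V, linkE B U V * Real.exp (-(1 / 2 + τ) * B * wilsonAction su2Rep V) ∂(configMeasure SU2 1) ≤ Λ) :
    ∫ p, a p.1 * transferKernel su2Rep B p.1 p.2 * a p.2 ∂((configMeasure SU2 1).prod (configMeasure SU2 1))
      ≤ Λ * ∫ U, a U ^ 2 ∂(configMeasure SU2 1) := by
  -- the restricted kernel and the weight
  set KS : Cfg → Cfg → ℝ := fun U V => if U ∈ S ∧ V ∈ S then transferKernel su2Rep B U V else 0 with hKS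
  set h : Cfg → ℝ := fun U => Real.exp (-(τ * B * wilsonAction su2Rep U)) with hh
  have hSm : Measurable fun U : Cfg => wilsonAction su2Rep U := (continuous_wilsonAction su2Rep continuous_su2Rep).measurable
  have hhm : Measurable h := Real.measurable_exp.comp (measurable_const.mul hSm).neg
  have hhpos : ∀ U, 0 < h U := fun U => Real.exp_pos _
  have hKS0 : ∀ U V, 0 ≤ KS U V := fun U V => by
    rw [hKS]; dsimp only; split_ifs
    · exact (transferKernel_pos _ _ _ _).le
    · exact le_rfl
  have hKSle : ∀ U V, KS U V ≤ transferKernel su2Rep B U V := fun U V => by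
    rw [hKS]; dsimp only; split_ifs
    · exact le_rfl
    · exact (transferKernel_pos _ _ _ _).le
  have hKSsymm : ∀ U V, KS U V = KS V U := fun U V => by
    rw [hKS]; dsimp only
    rw [transferKernel_su2Rep_symm B U V]
    by_cases hU : U ∈ S <;> by_cases hV : V ∈ S <;> simp [hU, hV]
  have hKSm : Measurable fun p : Cfg × Cfg => KS p.1 p.2 := by
    rw [hKS]
    exact Measurable.ite (hS.prod hS) (measurable_transferKernel_su2 B) measurable_const
  have hKSb : ∀ p : Cfg × Cfg, |KS p.1 p.2| ≤ Real.exp (2 * B) ^ Fintype.card (Edge 3 1) := fun p => by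
    rw [abs_of_nonneg (hKS0 _ _)]
    exact (hKSle _ _).trans ((abs_transferKernel_le hB.le p).trans' (le_abs_self _))
  -- the integrand does not see the restriction
  have hsame : ∀ p : Cfg × Cfg, a p.1 * transferKernel su2Rep B p.1 p.2 * a p.2 = a p.1 * KS p.1 p.2 * a p.2 := by
    intro p
    rw [hKS]; dsimp only
    split_ifs with hp
    · rfl
    · rw [not_and_or] at hp
      rcases hp with hp | hp
      · rw [ha0 _ hp]; ring
      · rw [ha0 _ hp]; ring
  have hI0 := integrable_bilin hB.le ha ha hab hab
  rw [integral_congr_ae (ae_of_all _ hsame)]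
  have hI : Integrable (fun p : Cfg × Cfg => a p.1 * KS p.1 p.2 * a p.2) ((configMeasure SU2 1).prod (configMeasure SU2 1)) :=
    hI0.congr (ae_of_all _ hsame)
  have eprod := integral_prod (fun p : Cfg × Cfg => a p.1 * KS p.1 p.2 * a p.2) hI
  simp only at eprod
  rw [eprod]
  -- the ratio `h(V)/h(U)` is bounded
  obtain ⟨C, hC⟩ := hab
  have hSmax := fun U : Cfg => wilsonAction_su2_le_card U
  have hS0 := fun U : Cfg => wilsonAction_su2_nonneg U
  set M : ℝ := 4 * Fintype.card (Plaquette 3 1) with hM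
  have hratio : ∀ U V : Cfg, h V / h U ≤ Real.exp (|τ| * B * M) := by
    intro U V
    rw [hh]; dsimp only
    rw [← Real.exp_sub]
    refine Real.exp_le_exp.2 ?_
    have h1 : -(τ * B * wilsonAction su2Rep V) - -(τ * B * wilsonAction su2Rep U)
        = τ * B * (wilsonAction su2Rep U - wilsonAction su2Rep V) := by ring
    have h2 : |τ * B * (wilsonAction su2Rep U - wilsonAction su2Rep V)| ≤ |τ| * B * M := by
      rw [abs_mul, abs_mul, abs_of_pos hB]
      refine mul_le_mul_of_nonneg_left ?_ (by positivity)
      rw [abs_le]; constructor <;> nlinarith [hSmax U, hSmax V, hS0 U, hS0 V]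
    linarith [h1, (abs_le.1 h2).2]
  have hψ : Integrable (fun U => a U ^ 2) (configMeasure SU2 1) :=
    integrable_configMeasure_of_bounded (ha.pow_const 2)
      ⟨C ^ 2, fun U => by rw [abs_pow]; exact pow_le_pow_left₀ (abs_nonneg _) (hC U) 2⟩
  have hI₁ : Integrable (fun p : Cfg × Cfg => KS p.1 p.2 * h p.2 / h p.1 * a p.1 ^ 2)
      ((configMeasure SU2 1).prod (configMeasure SU2 1)) := by
    refine integrable_cfgProd (((hKSm.mul (hhm.comp measurable_snd)).div (hhm.comp measurable_fst)).mul
      ((ha.pow_const 2).comp measurable_fst))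
      (C := Real.exp (2 * B) ^ Fintype.card (Edge 3 1) * Real.exp (|τ| * B * M) * C ^ 2) fun p => ?_
    · rw [show KS p.1 p.2 * h p.2 / h p.1 * a p.1 ^ 2 = KS p.1 p.2 * (h p.2 / h p.1) * a p.1 ^ 2 by ring, abs_mul, abs_mul,
        abs_of_nonneg (div_pos (hhpos _) (hhpos _)).le]
      refine mul_le_mul (mul_le_mul (hKSb p) (hratio _ _) (div_pos (hhpos _) (hhpos _)).le (by positivity)) ?_
        (abs_nonneg _) (by positivity)
      rw [abs_pow]; exact pow_le_pow_left₀ (abs_nonneg _) (hC _) 2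
  have hI₂ : Integrable (fun p : Cfg × Cfg => KS p.1 p.2 * h p.1 / h p.2 * a p.2 ^ 2)
      ((configMeasure SU2 1).prod (configMeasure SU2 1)) := by
    refine integrable_cfgProd (((hKSm.mul (hhm.comp measurable_fst)).div (hhm.comp measurable_snd)).mul
      ((ha.pow_const 2).comp measurable_snd))
      (C := Real.exp (2 * B) ^ Fintype.card (Edge 3 1) * Real.exp (|τ| * B * M) * C ^ 2) fun p => ?_
    · rw [show KS p.1 p.2 * h p.1 / h p.2 * a p.2 ^ 2 = KS p.1 p.2 * (h p.1 / h p.2) * a p.2 ^ 2 by ring, abs_mul, abs_mul,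
        abs_of_nonneg (div_pos (hhpos _) (hhpos _)).le]
      refine mul_le_mul (mul_le_mul (hKSb p) (hratio _ _) (div_pos (hhpos _) (hhpos _)).le (by positivity)) ?_
        (abs_nonneg _) (by positivity)
      rw [abs_pow]; exact pow_le_pow_left₀ (abs_nonneg _) (hC _) 2
  -- the supersolution inequality for the restricted kernel
  have hrow' : ∀ᵐ U ∂(configMeasure SU2 1), ∫ V, KS U V * h V ∂(configMeasure SU2 1) ≤ Λ * h U := by
    refine ae_of_all _ fun U => ?_
    by_cases hU : U ∈ S
    · -- compare with the unrestricted integral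
      have hEm : Measurable fun V : Cfg => linkE B U V := by
        unfold linkE
        refine Finset.measurable_prod _ fun e _ => (measurable_linkW B).comp ?_
        exact measurable_const.mul (measurable_pi_apply e).inv
      have hfull_int : Integrable (fun V => transferKernel su2Rep B U V * h V) (configMeasure SU2 1) := by
        refine integrable_configMeasure_of_bounded (((measurable_transferKernel_su2 B).comp
          (measurable_const.prodMk measurable_id)).mul hhm) ⟨Real.exp (2 * B) ^ Fintype.card (Edge 3 1) * Real.exp (|τ| * B * M),
            fun V => ?_⟩
        rw [abs_mul, abs_of_pos (hhpos V)]
        refine mul_le_mul (abs_transferKernel_le hB.le (U, V)) ?_ (hhpos V).le (by positivity)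
        rw [hh]; dsimp only
        refine Real.exp_le_exp.2 ?_
        have : |τ * B * wilsonAction su2Rep V| ≤ |τ| * B * M := by
          rw [abs_mul, abs_mul, abs_of_pos hB, abs_of_nonneg (hS0 V)]
          exact mul_le_mul_of_nonneg_left (hSmax V) (by positivity)
        linarith [(abs_le.1 this).1]
      have hKS_int : Integrable (fun V => KS U V * h V) (configMeasure SU2 1) :=
        hfull_int.mono' ((hKSm.comp (measurable_const.prodMk measurable_id)).mul hhm).aestronglyMeasurable
          (ae_of_all _ fun V => by
            rw [Real.norm_eq_abs, abs_mul, abs_of_nonneg (hKS0 _ _), abs_of_pos (hhpos _)]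
            exact mul_le_mul_of_nonneg_right (hKSle _ _) (hhpos _).le)
      have hle : ∫ V, KS U V * h V ∂(configMeasure SU2 1) ≤ ∫ V, transferKernel su2Rep B U V * h V ∂(configMeasure SU2 1) :=
        integral_mono hKS_int hfull_int fun V => mul_le_mul_of_nonneg_right (hKSle _ _) (hhpos _).le
      refine hle.trans ?_
      -- `∫ K h = h(U) · J_τ(U)`
      have e : ∀ V, transferKernel su2Rep B U V * h V
          = Real.exp (-(τ * B * wilsonAction su2Rep U)) * (Real.exp ((τ - 1 / 2) * B * wilsonAction su2Rep U)
            * (linkE B U V * Real.exp (-(1 / 2 + τ) * B * wilsonAction su2Rep V))) := by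
        intro V
        rw [transferKernel_eq_linkE_mul, hh]; dsimp only
        have : linkE B U V * Real.exp (-(B / 2) * (wilsonAction su2Rep U + wilsonAction su2Rep V))
            * Real.exp (-(τ * B * wilsonAction su2Rep V))
            = linkE B U V * (Real.exp (-(B / 2) * (wilsonAction su2Rep U + wilsonAction su2Rep V))
              * Real.exp (-(τ * B * wilsonAction su2Rep V))) := by ring
        rw [this, ← Real.exp_add]
        have : Real.exp (-(τ * B * wilsonAction su2Rep U)) * (Real.exp ((τ - 1 / 2) * B * wilsonAction su2Rep U)
            * (linkE B U V * Real.exp (-(1 / 2 + τ) * B * wilsonAction su2Rep V)))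
            = linkE B U V * (Real.exp (-(τ * B * wilsonAction su2Rep U)) * Real.exp ((τ - 1 / 2) * B * wilsonAction su2Rep U)
              * Real.exp (-(1 / 2 + τ) * B * wilsonAction su2Rep V)) := by ring
        rw [this, ← Real.exp_add, ← Real.exp_add]
        congr 2; ring
      simp_rw [e]
      rw [integral_const_mul, integral_const_mul]
      have hJ := hrow U hU
      calc Real.exp (-(τ * B * wilsonAction su2Rep U)) * (Real.exp ((τ - 1 / 2) * B * wilsonAction su2Rep U) *
            ∫ V, linkE B U V * Real.exp (-(1 / 2 + τ) * B * wilsonAction su2Rep V) ∂configMeasure SU2 1)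
          ≤ Real.exp (-(τ * B * wilsonAction su2Rep U)) * Λ := mul_le_mul_of_nonneg_left hJ (Real.exp_pos _).le
        _ = Λ * h U := by rw [hh]; ring
    · have hz : ∀ V, KS U V * h V = 0 := fun V => by rw [hKS]; dsimp only; rw [if_neg (fun hp => hU hp.1), zero_mul]
      simp_rw [hz]
      rw [integral_zero]
      exact mul_nonneg hΛ (hhpos U).le
  exact integral_integral_mul_kernel_mul_self_le_weighted_of_symm KS a h hKS0 hKSsymm hhpos hrow' hψ hI hI₁ hI₂

end Bilinear

/-! ### §3. Pieces, cross terms, and the pigeonholed slab -/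

section Assembly


variable {B : ℝ}

/-- Pieces `1_A f` of a bounded measurable `f` on measurable radial sets are bounded measurable. [folklore] -/
theorem piece_props {A : Set Cfg} (hA : MeasurableSet A) {f : Cfg → ℝ} (hfm : Measurable f) (hfb : ∃ C : ℝ, ∀ U, |f U| ≤ C) :
    Measurable (A.indicator f) ∧ ∃ C : ℝ, ∀ U, |A.indicator f U| ≤ C := by
  obtain ⟨C, hC⟩ := hfb
  exact ⟨hfm.indicator hA, C, abs_indicator_le hC⟩

/-- Radial sets `{a ≤ ρ < b}` and `{a ≤ ρ}` are measurable. [folklore] -/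
theorem measurableSet_radial (a b : ℝ) :
    MeasurableSet {U : Cfg | a ≤ ‖zmCoord 1 U‖ ∧ ‖zmCoord 1 U‖ < b} ∧ MeasurableSet {U : Cfg | a ≤ ‖zmCoord 1 U‖} := by
  have hm : Measurable fun U : Cfg => ‖zmCoord 1 U‖ := continuous_valleyRadius.measurable
  exact ⟨(measurableSet_le measurable_const hm).inter (measurableSet_lt hm measurable_const), measurableSet_le measurable_const hm⟩

/-- **Cross terms between the two shells.**  If `1_P f = 1_A f + 1_{A'} f` and `1_Q f = 1_C f + 1_{C'} f` pointwise, the kernel is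
`≤ ε` across the pairs `(A,C)`, `(A,C')`, `(A',C')`, and `(A',C)` is the pair of adjacent slabs, then
`∫ (1_P f) K_B (1_Q f) ≤ ε/2·(…) + linkCE B/2·(∫(1_{A'}f)² + ∫(1_C f)²) + ε/2·(…)`. [cite: Helffer2013, Lemma 7.1 pp.77–78] -/
theorem cross_bound (hB : 0 < B) {f : Cfg → ℝ} (hfm : Measurable f) (hfb : ∃ C : ℝ, ∀ U, |f U| ≤ C)
    {P Q A A' C C' : Set Cfg} (hP : MeasurableSet P) (hQ : MeasurableSet Q) (hA : MeasurableSet A) (hA' : MeasurableSet A')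
    (hC : MeasurableSet C) (hC' : MeasurableSet C')
    (hPdec : ∀ U, P.indicator f U = A.indicator f U + A'.indicator f U)
    (hQdec : ∀ U, Q.indicator f U = C.indicator f U + C'.indicator f U)
    {ε : ℝ} (hε0 : 0 ≤ ε)
    (gAC : ∀ U V, A.indicator f U ≠ 0 → C.indicator f V ≠ 0 → transferKernel su2Rep B U V ≤ ε)
    (gAC' : ∀ U V, A.indicator f U ≠ 0 → C'.indicator f V ≠ 0 → transferKernel su2Rep B U V ≤ ε)
    (gA'C' : ∀ U V, A'.indicator f U ≠ 0 → C'.indicator f V ≠ 0 → transferKernel su2Rep B U V ≤ ε) :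
    ∫ p, P.indicator f p.1 * transferKernel su2Rep B p.1 p.2 * Q.indicator f p.2 ∂((configMeasure SU2 1).prod (configMeasure SU2 1))
      ≤ ε / 2 * ((∫ U, A.indicator f U ^ 2 ∂(configMeasure SU2 1)) + ∫ U, C.indicator f U ^ 2 ∂(configMeasure SU2 1))
        + ε / 2 * ((∫ U, A.indicator f U ^ 2 ∂(configMeasure SU2 1)) + ∫ U, C'.indicator f U ^ 2 ∂(configMeasure SU2 1))
        + (linkCE B / 2 * ((∫ U, A'.indicator f U ^ 2 ∂(configMeasure SU2 1)) + ∫ U, C.indicator f U ^ 2 ∂(configMeasure SU2 1))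
        + ε / 2 * ((∫ U, A'.indicator f U ^ 2 ∂(configMeasure SU2 1)) + ∫ U, C'.indicator f U ^ 2 ∂(configMeasure SU2 1))) := by
  obtain ⟨ham, hab⟩ := piece_props hA hfm hfb
  obtain ⟨ha'm, ha'b⟩ := piece_props hA' hfm hfb
  obtain ⟨hcm, hcb⟩ := piece_props hC hfm hfb
  obtain ⟨hc'm, hc'b⟩ := piece_props hC' hfm hfb
  have _hPm := hP; have _hQm := hQ
  rw [integral_congr_ae (ae_of_all _ fun p : Cfg × Cfg =>
    show P.indicator f p.1 * transferKernel su2Rep B p.1 p.2 * Q.indicator f p.2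
      = (A.indicator f p.1 + A'.indicator f p.1) * transferKernel su2Rep B p.1 p.2 * (C.indicator f p.2 + C'.indicator f p.2) by
      rw [← hPdec, ← hQdec])]
  rw [prodIntegral_add_left hB.le (b := fun V => C.indicator f V + C'.indicator f V) ham ha'm (hcm.add hc'm) hab ha'b (by
        obtain ⟨C1, hC1⟩ := hcb; obtain ⟨C2, hC2⟩ := hc'b
        exact ⟨C1 + C2, fun U => (abs_add_le _ _).trans (add_le_add (hC1 U) (hC2 U))⟩),
    prodIntegral_add_right hB.le ham hcm hc'm hab hcb hc'b,
    prodIntegral_add_right hB.le ha'm hcm hc'm ha'b hcb hc'b]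
  refine add_le_add (add_le_add ?_ ?_) (add_le_add ?_ ?_)
  · exact prodIntegral_le_of_sep hB.le hε0 ham hcm hab hcb gAC
  · exact prodIntegral_le_of_sep hB.le hε0 ham hc'm hab hc'b gAC'
  · exact prodIntegral_le_linkCE hB.le ha'm hcm ha'b hcb
  · exact prodIntegral_le_of_sep hB.le hε0 ha'm hc'm ha'b hc'b gA'C'

/-- **Pigeonhole for the slab.**  Among `J ≥ 1` disjoint radial slabs `{T + 2jw ≤ ρ < T + (2j+2)w}` one carries at most `‖f‖²/J` of the
mass of `f`. [folklore] -/
theorem exists_light_slab {T w : ℝ} (hw : 0 < w) {J : ℕ} (hJ : 0 < J) {f : Cfg → ℝ} (hfm : Measurable f)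
    (hfb : ∃ C : ℝ, ∀ U, |f U| ≤ C) :
    ∃ j : ℕ, j < J ∧ ∫ U, {U : Cfg | T + 2 * j * w ≤ ‖zmCoord 1 U‖ ∧ ‖zmCoord 1 U‖ < T + (2 * j + 2) * w}.indicator f U ^ 2
      ∂(configMeasure SU2 1) ≤ (∫ U, f U ^ 2 ∂(configMeasure SU2 1)) / J := by
  obtain ⟨Cf, hCf⟩ := hfb
  have hf2int : ∀ (A : Set Cfg), MeasurableSet A → Integrable (fun U => A.indicator f U ^ 2) (configMeasure SU2 1) :=
    fun A hA => integrable_configMeasure_of_bounded ((hfm.indicator hA).pow_const 2)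
      ⟨Cf ^ 2, fun U => by rw [abs_pow]; exact pow_le_pow_left₀ (abs_nonneg _) (abs_indicator_le hCf U) 2⟩
  set N : ℕ → Set Cfg := fun j => {U | T + 2 * j * w ≤ ‖zmCoord 1 U‖ ∧ ‖zmCoord 1 U‖ < T + (2 * j + 2) * w} with hN
  have hNm : ∀ j, MeasurableSet (N j) := fun j => (measurableSet_radial _ _).1
  have hNdisj : ∀ U, ∀ j j', U ∈ N j → U ∈ N j' → j = j' := by
    intro U j j' hj hj'
    simp only [hN, Set.mem_setOf_eq] at hj hj'
    by_contra hne
    rcases lt_or_gt_of_ne hne with h | h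
    · have : (j : ℝ) + 1 ≤ j' := by exact_mod_cast h
      nlinarith [hj.2, hj'.1]
    · have : (j' : ℝ) + 1 ≤ j := by exact_mod_cast h
      nlinarith [hj'.2, hj.1]
  have hpt_sum : ∀ U, ∑ j ∈ Finset.range J, (N j).indicator f U ^ 2 ≤ f U ^ 2 := by
    intro U
    by_cases hex : ∃ j ∈ Finset.range J, U ∈ N j
    · obtain ⟨j, hj, hU⟩ := hex
      rw [Finset.sum_eq_single_of_mem j hj fun j' hj' hne => by
        rw [Set.indicator_of_notMem (fun h => hne (hNdisj U j' j h hU)), zero_pow two_ne_zero]]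
      rw [Set.indicator_of_mem hU]
    · push Not at hex
      rw [Finset.sum_eq_zero fun j hj => by rw [Set.indicator_of_notMem (hex j hj), zero_pow two_ne_zero]]
      exact sq_nonneg _
  have hsum : ∑ j ∈ Finset.range J, ∫ U, (N j).indicator f U ^ 2 ∂(configMeasure SU2 1) ≤ ∫ U, f U ^ 2 ∂(configMeasure SU2 1) := by
    rw [← integral_finsetSum _ fun j _ => hf2int (N j) (hNm j)]
    exact integral_mono (integrable_finsetSum _ fun j _ => hf2int (N j) (hNm j))
      (integrable_configMeasure_of_bounded (hfm.pow_const 2)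
        ⟨Cf ^ 2, fun U => by rw [abs_pow]; exact pow_le_pow_left₀ (abs_nonneg _) (hCf U) 2⟩) hpt_sum
  by_contra hcon
  push Not at hcon
  have hcon' : ∀ j ∈ Finset.range J, (∫ U, f U ^ 2 ∂(configMeasure SU2 1)) / J
      < ∫ U, (N j).indicator f U ^ 2 ∂(configMeasure SU2 1) := fun j hj => hcon j (Finset.mem_range.1 hj)
  have hlt := Finset.sum_lt_sum_of_nonempty ⟨0, Finset.mem_range.2 hJ⟩ hcon'
  rw [Finset.sum_const, Finset.card_range, nsmul_eq_mul] at hlt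
  have hJ0 : (0 : ℝ) < J := by exact_mod_cast hJ
  have : (J : ℝ) * ((∫ U, f U ^ 2 ∂(configMeasure SU2 1)) / J) = ∫ U, f U ^ 2 ∂(configMeasure SU2 1) := by field_simp
  linarith

end Assembly

end Summit.QuantumFields.YangMills.Theorems.FemtoTransferGap

end
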